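import Mathlib
import Literature.Analysis.FluidPDE.SuitableWeak
import Literature.Analysis.FluidPDE.SelfSimilarCollapseAnsatz
import Literature.Analysis.FluidPDE.PoincareHomotopyOperatorL2
import Summits.NavierStokesRegularity.NavierStokesRegularity.Theorems.EulerZoomLiouvillePowerGaugeEulerLiouvilleSelfSimilarLEI
import HarnessLib

/-!
# Rung C1 of the crux `EulerZoomLiouville.PowerGaugeEulerLiouville`: the `A`-gauge in profile
# variables and the transfer of C1 to a profile Liouville statement

Route №10 `EulerZoomLiouville` (NavierStokesRegularity), crux E = stmt-NavierStokesRegularity-19832,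
tenure rung C1 (`Cruxes/PowerGaugeEulerLiouville/Lines/rungC_window.lean`, `Sig.rungC1_selfSimilar`:
exactly self-similar members of Seregin's power-gauged ancient Euler class vanish; open in the
window `0 < ρ ≤ 1/2` = Chae–Shvydkoy's `α = 1+ρ ∈ (1, 3/2]`).  Companion of
`…SelfSimilarLEI.lean` (the local energy inequality in profile variables).  Here:

* `aestronglyMeasurable_profile` — the profile `V` of a self-similar member is a.e.-strongly
  measurable (a measurable slice, undone by a dilation);
* `lintegral_ball_enorm_sq_selfSimilarCollapse` — exact scaling of the ball energies of the
  ansatz (`ℝ≥0∞` version of the tree's `setIntegral_norm_sq_selfSimilarCollapse_ball`);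
* `profile_energy_growth_of_gaugeA` — the `A`-GAUGE IN PROFILE VARIABLES: `a^{2ρ} A(a; 0) ≤ c`
  for all `a > 0` gives `∫_{B_L} |V|² ≤ c · L^{1−2ρ}` for EVERY `L > 0`, with the same constant
  (Chae–Shvydkoy 2013, (1.3)/Cor. 3.4: the energy growth `L^{N−2α}` is "a natural internal feature
  of the blow-up" — here it is literally the `A`-gauge); at the endpoint `ρ = 1/2` (`α = N/2`):
  `∫ |V|² ≤ c`, i.e. `V ∈ L²(ℝ³)` (`lintegral_enorm_sq_profile_le_of_half`);
* `selfSimilar_ae_eq_zero_of_profile` — if the profile vanishes a.e. then the member vanishes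
  a.e. on the slab;
* `rungC1_of_profileLiouville` — TRANSFER: rung C1 at exponent `ρ` follows from a Liouville
  theorem for profiles `(V, P)` carrying (i) the growth bound above and (ii) the forward profile
  local energy inequality of `…SelfSimilarLEI.selfSimilar_profile_energy_le_add_flux`.
  At `ρ = 1/2` hypothesis (i) is `V ∈ L²`: Chae–Shvydkoy's Thm 3.1 proves such a Liouville
  theorem only under the extra two-sided power bounds `c|y|^{−(4−δ)} ≤ |V| ≤ C|y|^{1−δ}` and for the
  associated (Riesz) pressure; neither is part of E's class — this is the honest residue of
  C1 at the endpoint, typed.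

WHAT THIS IS NOT: not NS, not E, not rung C1 — bookkeeping that moves C1's hypotheses to
profile space; the profile Liouville theorem in the window is open (Chae–Shvydkoy's window).
-/

noncomputable section

set_option linter.dupNamespace false

open MeasureTheory Set Filter Topology Metric Function TopologicalSpace
open scoped ENNReal NNReal InnerProductSpace RealInnerProductSpace

namespace Summit.NavierStokesRegularity.NavierStokesRegularity.Theorems.PowerGaugeEulerLiouville

open Literature.Analysis Literature.Analysis.FunctionSpaces Literature.Analysis.FluidPDE

/-! ## Measurability of the profile -/

section Measurability

/-- Dilations of `ℝ³` are quasi-measure-preserving for Lebesgue measure. [folklore] -/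
theorem quasiMeasurePreserving_smul {r : ℝ} (hr : r ≠ 0) :
    Measure.QuasiMeasurePreserving (fun x : EuclideanSpace ℝ (Fin 3) => r • x) volume volume := by
  refine ⟨measurable_const_smul r, ?_⟩
  rw [Measure.map_addHaar_smul volume hr]
  exact Measure.smul_absolutelyContinuous

/-- **The profile of an exactly self-similar member is a.e.-strongly measurable.**  If
`(τ, x) ↦ u τ x` is a.e.-strongly measurable on the slab `(−∞,0) × ℝ³` (e.g. locally integrable
there) and `u(τ) = selfSimilarCollapse γ 0 V τ` for `τ < 0`, then `V` is a.e.-strongly measurable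
on `ℝ³`: some slice `u(τ₀)` is measurable (Fubini) and `V = (−τ₀)^{1−γ} u(τ₀)((−τ₀)^{γ} ·)`. [folklore] -/
theorem aestronglyMeasurable_profile {γ : ℝ}
    {u : ℝ → EuclideanSpace ℝ (Fin 3) → EuclideanSpace ℝ (Fin 3)}
    {V : EuclideanSpace ℝ (Fin 3) → EuclideanSpace ℝ (Fin 3)}
    (hum : AEStronglyMeasurable (uncurry u)
      (volume.restrict (Iio (0 : ℝ) ×ˢ (univ : Set (EuclideanSpace ℝ (Fin 3))))))
    (hu : ∀ τ : ℝ, τ < 0 → u τ = selfSimilarCollapse γ 0 V τ) :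
    AEStronglyMeasurable V volume := by
  rw [Measure.volume_eq_prod, ← Measure.prod_restrict, Measure.restrict_univ] at hum
  have h1 := hum.prodMk_left
  haveI : (ae ((volume : Measure ℝ).restrict (Iio (0 : ℝ)))).NeBot := by
    rw [ae_neBot, Ne, Measure.restrict_eq_zero]
    simp
  have h2 : ∀ᵐ τ ∂((volume : Measure ℝ).restrict (Iio (0 : ℝ))), τ < 0 :=
    (ae_restrict_mem measurableSet_Iio)
  obtain ⟨τ₀, hτ₀m, hτ₀⟩ := (h1.and h2).exists
  have hs : 0 < -τ₀ := neg_pos.2 hτ₀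
  -- `u(τ₀) = c • V (d • ·)` with `c = (−τ₀)^{γ−1}`, `d = (−τ₀)^{−γ}`
  have hslice : AEStronglyMeasurable (fun x => (-τ₀) ^ (γ - 1) • V ((-τ₀) ^ (-γ) • x)) volume := by
    have : (fun y => uncurry u (τ₀, y)) = fun x => (-τ₀) ^ (γ - 1) • V ((-τ₀) ^ (-γ) • x) := by
      funext x
      simp only [uncurry, hu τ₀ hτ₀, selfSimilarCollapse_apply, zero_sub]
    rw [← this]; exact hτ₀m
  have hVd : AEStronglyMeasurable (fun x => V ((-τ₀) ^ (-γ) • x)) volume := by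
    have heq : (fun x => V ((-τ₀) ^ (-γ) • x)) =
        ((-τ₀) ^ (γ - 1))⁻¹ • (fun x => (-τ₀) ^ (γ - 1) • V ((-τ₀) ^ (-γ) • x)) := by
      funext x
      simp only [Pi.smul_apply, smul_smul, inv_mul_cancel₀ (Real.rpow_pos_of_pos hs _).ne', one_smul]
    rw [heq]
    exact hslice.const_smul _
  -- undo the dilation
  have hd : (-τ₀) ^ γ ≠ 0 := (Real.rpow_pos_of_pos hs _).ne'
  have key := hVd.comp_quasiMeasurePreserving (quasiMeasurePreserving_smul hd)
  have heq : ((fun x => V ((-τ₀) ^ (-γ) • x)) ∘ fun x : EuclideanSpace ℝ (Fin 3) => (-τ₀) ^ γ • x) = V := by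
    funext x
    simp only [comp_apply, smul_smul, Real.rpow_neg hs.le, inv_mul_cancel₀ hd, one_smul]
  rwa [heq] at key

end Measurability

/-! ## The `A`-gauge in profile variables -/

section GaugeA

/-- **Ball energies of the ansatz (exact scaling, `ℝ≥0∞`).**  For `τ < 0`, `a : ℝ`:
`∫_{B_a} ‖u(τ,x)‖² dx = (−τ)^{5γ−2} ∫_{B_{a (−τ)^{−γ}}} ‖V‖²` for `u = selfSimilarCollapse γ 0 V`
(Chae–Shvydkoy 2013, §1, the computation behind (1.3); tree `lintegral_ball_comp_smul`). [cite: ChaeShvydkoy2013, §1 eq. (1.3)] -/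
theorem lintegral_ball_enorm_sq_selfSimilarCollapse (γ : ℝ) {τ : ℝ} (hτ : τ < 0)
    (V : EuclideanSpace ℝ (Fin 3) → EuclideanSpace ℝ (Fin 3)) (a : ℝ) :
    ∫⁻ x in ball (0 : EuclideanSpace ℝ (Fin 3)) a, ‖selfSimilarCollapse γ 0 V τ x‖ₑ ^ 2 =
      ENNReal.ofReal ((-τ) ^ (5 * γ - 2)) *
        ∫⁻ y in ball (0 : EuclideanSpace ℝ (Fin 3)) ((-τ) ^ (-γ) * a), ‖V y‖ₑ ^ 2 := by
  have hs : 0 < -τ := neg_pos.2 hτ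
  have ht : 0 < (-τ) ^ (-γ) := Real.rpow_pos_of_pos hs _
  have h1 : ∀ x, ‖selfSimilarCollapse γ 0 V τ x‖ₑ ^ 2 =
      ENNReal.ofReal ((-τ) ^ (2 * (γ - 1))) * ‖V ((-τ) ^ (-γ) • x)‖ₑ ^ 2 := by
    intro x
    rw [← ofReal_norm, norm_selfSimilarCollapse hτ, zero_sub, ← ofReal_norm (V _),
      ← ENNReal.ofReal_pow (by positivity), ← ENNReal.ofReal_pow (norm_nonneg _),
      ← ENNReal.ofReal_mul (by positivity), mul_pow, ← Real.rpow_natCast ((-τ) ^ (γ - 1)) 2,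
      ← Real.rpow_mul hs.le, show (γ - 1) * ((2 : ℕ) : ℝ) = 2 * (γ - 1) by push_cast; ring]
  simp_rw [h1]
  rw [lintegral_const_mul' _ _ ENNReal.ofReal_ne_top,
    lintegral_ball_comp_smul (fun y => ‖V y‖ₑ ^ 2) ht a, ← mul_assoc,
    ← ENNReal.ofReal_mul (by positivity)]
  congr 2
  rw [← Real.rpow_natCast ((-τ) ^ (-γ)) 3, ← Real.rpow_mul hs.le, ← Real.rpow_neg hs.le,
    ← Real.rpow_add hs]
  congr 1
  push_cast
  ring

/-- **The `A`-gauge in profile variables (Chae–Shvydkoy's (1.3) with the sharp constant).**  If a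
field `u` on `(−∞,0) × ℝ³` is exactly self-similar with exponent `γ = 1/(2+ρ)`, `ρ > 0`, and its
power-gauged scaled energy at the origin satisfies `a^{2ρ} A(a; 0) ≤ c` for all `a > 0`
(`A = cknA`), then the profile obeys `∫_{B_L} ‖V‖² ≤ c · L^{1−2ρ}` for EVERY `L > 0` (= CS13's
`L^{N−2α}`, `N − 2α = 1 − 2ρ`).  Proof: read the gauge at radius `a = L s^{γ}` and time `τ = −s`
with `s^{1−2γ} = L²/2 < L²` (so `τ ∈ (−a², 0)`); the exponents cancel exactly since
`γ (2 + ρ) = 1`. [cite: ChaeShvydkoy2013, §1 eq. (1.3) and §3.2.3 Cor. 3.4] -/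
theorem profile_energy_growth_of_gaugeA {ρ : ℝ} (hρ : 0 < ρ)
    {u : ℝ → EuclideanSpace ℝ (Fin 3) → EuclideanSpace ℝ (Fin 3)}
    {V : EuclideanSpace ℝ (Fin 3) → EuclideanSpace ℝ (Fin 3)} {c : ℝ≥0}
    (hu : ∀ τ : ℝ, τ < 0 → u τ = selfSimilarCollapse (1 / (2 + ρ)) 0 V τ)
    (hA : ∀ a : ℝ, 0 < a → ENNReal.ofReal (a ^ (2 * ρ)) *
      cknA a (0 : ℝ × EuclideanSpace ℝ (Fin 3)) u ≤ (c : ℝ≥0∞)) :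
    ∀ L : ℝ, 0 < L →
      ∫⁻ y in ball (0 : EuclideanSpace ℝ (Fin 3)) L, ‖V y‖ₑ ^ 2 ≤
        (c : ℝ≥0∞) * ENNReal.ofReal (L ^ (1 - 2 * ρ)) := by
  intro L hL
  set γ : ℝ := 1 / (2 + ρ) with hγ
  have h2ρ : 0 < 2 + ρ := by linarith
  have hγρ : γ * (2 + ρ) = 1 := by rw [hγ]; field_simp
  have hγ0 : 0 < γ := by rw [hγ]; positivity
  have h12γ : 0 < 1 - 2 * γ := by
    rw [hγ, show 2 * (1 / (2 + ρ)) = 2 / (2 + ρ) by ring, sub_pos, div_lt_one h2ρ]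
    linarith
  -- the time `s` and the radius `a`
  set s : ℝ := (L ^ 2 / 2) ^ (1 / (1 - 2 * γ)) with hsdef
  have hs : 0 < s := Real.rpow_pos_of_pos (by positivity) _
  have hs12 : s ^ (1 - 2 * γ) = L ^ 2 / 2 := by
    rw [hsdef, ← Real.rpow_mul (by positivity), one_div_mul_cancel h12γ.ne', Real.rpow_one]
  set a : ℝ := L * s ^ γ with hadef
  have hsγ : 0 < s ^ γ := Real.rpow_pos_of_pos hs _
  have ha : 0 < a := mul_pos hL hsγ
  have haL : (-(-s)) ^ (-γ) * a = L := by
    rw [neg_neg, hadef, Real.rpow_neg hs.le, mul_comm, mul_assoc, mul_inv_cancel₀ hsγ.ne', mul_one]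
  -- `τ = −s ∈ (−a², 0)`
  -- `s < a² ⟺ s^{1−2γ} < L²`
  have hlt : s < a ^ 2 := by
    have h1 : a ^ 2 = L ^ 2 * s ^ (2 * γ) := by
      rw [hadef, mul_pow, ← Real.rpow_natCast (s ^ γ) 2, ← Real.rpow_mul hs.le]
      congr 2; push_cast; ring
    have h2 : s = s ^ (1 - 2 * γ) * s ^ (2 * γ) := by
      rw [← Real.rpow_add hs]; norm_num
    have h3 : 0 < s ^ (2 * γ) := Real.rpow_pos_of_pos hs _
    calc s = s ^ (1 - 2 * γ) * s ^ (2 * γ) := h2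
      _ = L ^ 2 / 2 * s ^ (2 * γ) := by rw [hs12]
      _ < L ^ 2 * s ^ (2 * γ) := by
          apply mul_lt_mul_of_pos_right _ h3
          have : 0 < L ^ 2 := by positivity
          linarith
      _ = a ^ 2 := h1.symm
  have hτ : (-s) ∈ Ioo ((0 : ℝ × EuclideanSpace ℝ (Fin 3)).1 - a ^ 2) (0 : ℝ × EuclideanSpace ℝ (Fin 3)).1 := by
    simp only [Prod.fst_zero, zero_sub, mem_Ioo]
    exact ⟨by linarith, by linarith⟩
  -- the slice bound from the `A`-gauge
  have hslice : (ENNReal.ofReal a)⁻¹ * ∫⁻ x in ball (0 : EuclideanSpace ℝ (Fin 3)) a, ‖u (-s) x‖ₑ ^ 2 ≤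
      cknA a (0 : ℝ × EuclideanSpace ℝ (Fin 3)) u := by
    unfold cknA
    exact le_iSup₂ (f := fun t (_ : t ∈ Ioo ((0 : ℝ × EuclideanSpace ℝ (Fin 3)).1 - a ^ 2)
        (0 : ℝ × EuclideanSpace ℝ (Fin 3)).1) =>
        (ENNReal.ofReal a)⁻¹ * ∫⁻ x in ball (0 : ℝ × EuclideanSpace ℝ (Fin 3)).2 a, ‖u t x‖ₑ ^ 2) (-s) hτ
  have hgauge : ENNReal.ofReal (a ^ (2 * ρ)) * ((ENNReal.ofReal a)⁻¹ *
      ∫⁻ x in ball (0 : EuclideanSpace ℝ (Fin 3)) a, ‖u (-s) x‖ₑ ^ 2) ≤ (c : ℝ≥0∞) :=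
    calc ENNReal.ofReal (a ^ (2 * ρ)) * ((ENNReal.ofReal a)⁻¹ *
          ∫⁻ x in ball (0 : EuclideanSpace ℝ (Fin 3)) a, ‖u (-s) x‖ₑ ^ 2)
        ≤ ENNReal.ofReal (a ^ (2 * ρ)) * cknA a (0 : ℝ × EuclideanSpace ℝ (Fin 3)) u := by gcongr
      _ ≤ (c : ℝ≥0∞) := hA a ha
  -- rewrite the slice energy in profile variables
  rw [hu (-s) (by linarith), lintegral_ball_enorm_sq_selfSimilarCollapse γ (by linarith) V a, haL]
    at hgauge
  -- `hgauge : ofReal(a^{2ρ}) * ((ofReal a)⁻¹ * (ofReal(s^{5γ−2}) * Y)) ≤ c`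
  set Y := ∫⁻ y in ball (0 : EuclideanSpace ℝ (Fin 3)) L, ‖V y‖ₑ ^ 2 with hY
  have hss : 0 < (-(-s)) := by rw [neg_neg]; exact hs
  have hK : ENNReal.ofReal (a ^ (2 * ρ)) * ((ENNReal.ofReal a)⁻¹ * ENNReal.ofReal ((-(-s)) ^ (5 * γ - 2))) =
      ENNReal.ofReal (L ^ (2 * ρ - 1)) := by
    rw [neg_neg, ← ENNReal.ofReal_inv_of_pos ha, ← ENNReal.ofReal_mul (by positivity),
      ← ENNReal.ofReal_mul (by positivity)]
    congr 1
    -- `a^{2ρ} a⁻¹ s^{5γ−2} = L^{2ρ−1}` with `a = L s^γ`, `γ(2+ρ) = 1`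
    have hspart : s ^ (γ * (2 * ρ)) * (s ^ γ)⁻¹ * s ^ (5 * γ - 2) = 1 := by
      rw [← Real.rpow_neg hs.le, ← Real.rpow_add hs, ← Real.rpow_add hs,
        show γ * (2 * ρ) + -γ + (5 * γ - 2) = 0 by linear_combination 2 * hγρ, Real.rpow_zero]
    calc a ^ (2 * ρ) * (a⁻¹ * s ^ (5 * γ - 2))
        = (L ^ (2 * ρ) * L⁻¹) * (s ^ (γ * (2 * ρ)) * (s ^ γ)⁻¹ * s ^ (5 * γ - 2)) := by
          rw [hadef, Real.mul_rpow hL.le hsγ.le, ← Real.rpow_mul hs.le, mul_inv]; ring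
      _ = L ^ (2 * ρ - 1) := by rw [hspart, mul_one, Real.rpow_sub_one hL.ne', div_eq_mul_inv]
  have hfin : ENNReal.ofReal (L ^ (2 * ρ - 1)) * Y ≤ (c : ℝ≥0∞) := by
    rw [← hK]
    calc ENNReal.ofReal (a ^ (2 * ρ)) * ((ENNReal.ofReal a)⁻¹ * ENNReal.ofReal ((-(-s)) ^ (5 * γ - 2))) * Y
        = ENNReal.ofReal (a ^ (2 * ρ)) * ((ENNReal.ofReal a)⁻¹ * (ENNReal.ofReal ((-(-s)) ^ (5 * γ - 2)) * Y)) := by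
          ring
      _ ≤ (c : ℝ≥0∞) := hgauge
  -- unscale: `Y ≤ c · L^{1−2ρ}`
  have hL0 : ENNReal.ofReal (L ^ (2 * ρ - 1)) ≠ 0 := by
    rw [ENNReal.ofReal_ne_zero_iff]; exact Real.rpow_pos_of_pos hL _
  calc Y = ENNReal.ofReal (L ^ (1 - 2 * ρ)) * (ENNReal.ofReal (L ^ (2 * ρ - 1)) * Y) := by
        rw [← mul_assoc, ← ENNReal.ofReal_mul (by positivity), ← Real.rpow_add hL,
          show (1 - 2 * ρ) + (2 * ρ - 1) = 0 by ring, Real.rpow_zero, ENNReal.ofReal_one, one_mul]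
    _ ≤ ENNReal.ofReal (L ^ (1 - 2 * ρ)) * (c : ℝ≥0∞) := by gcongr
    _ = (c : ℝ≥0∞) * ENNReal.ofReal (L ^ (1 - 2 * ρ)) := mul_comm _ _

/-- **At the endpoint `ρ = 1/2` the `A`-gauge says `V ∈ L²(ℝ³)`:** `∫ ‖V‖² ≤ c` (the balls
exhaust `ℝ³`; Chae–Shvydkoy 2013, §1: "if … `α = N/2`, then automatically `v ∈ L²`"). [cite: ChaeShvydkoy2013, §1 (α = N/2 ⇒ v ∈ L²)] -/
theorem lintegral_enorm_sq_profile_le_of_half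
    {u : ℝ → EuclideanSpace ℝ (Fin 3) → EuclideanSpace ℝ (Fin 3)}
    {V : EuclideanSpace ℝ (Fin 3) → EuclideanSpace ℝ (Fin 3)} {c : ℝ≥0}
    (hu : ∀ τ : ℝ, τ < 0 → u τ = selfSimilarCollapse (1 / (2 + (1 / 2 : ℝ))) 0 V τ)
    (hA : ∀ a : ℝ, 0 < a → ENNReal.ofReal (a ^ (2 * (1 / 2 : ℝ))) *
      cknA a (0 : ℝ × EuclideanSpace ℝ (Fin 3)) u ≤ (c : ℝ≥0∞)) :
    ∫⁻ y, ‖V y‖ₑ ^ 2 ≤ (c : ℝ≥0∞) := by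
  have hgrowth := profile_energy_growth_of_gaugeA (by norm_num : (0 : ℝ) < 1 / 2) hu hA
  have hU : (⋃ n : ℕ, ball (0 : EuclideanSpace ℝ (Fin 3)) ((n : ℝ) + 1)) = univ := by
    refine eq_univ_of_forall fun y => mem_iUnion.2 ?_
    obtain ⟨n, hn⟩ := exists_nat_gt ‖y‖
    exact ⟨n, by rw [mem_ball_zero_iff]; linarith⟩
  have hdir : Directed (· ⊆ ·) fun n : ℕ => ball (0 : EuclideanSpace ℝ (Fin 3)) ((n : ℝ) + 1) :=
    Monotone.directed_le fun m n hmn => ball_subset_ball (by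
      have : (m : ℝ) ≤ n := Nat.cast_le.2 hmn
      linarith)
  rw [← setLIntegral_univ, ← hU, setLIntegral_iUnion_of_directed _ hdir]
  refine iSup_le fun n => ?_
  have h := hgrowth ((n : ℝ) + 1) (by positivity)
  simpa using h

end GaugeA

/-! ## From the profile back to the member -/

section Transfer

/-- **A self-similar member with a.e.-vanishing profile vanishes a.e. on the slab.** [folklore] -/
theorem selfSimilar_ae_eq_zero_of_profile {γ : ℝ}
    {u : ℝ → EuclideanSpace ℝ (Fin 3) → EuclideanSpace ℝ (Fin 3)}
    {V : EuclideanSpace ℝ (Fin 3) → EuclideanSpace ℝ (Fin 3)}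
    (hum : AEStronglyMeasurable (uncurry u)
      (volume.restrict (Iio (0 : ℝ) ×ˢ (univ : Set (EuclideanSpace ℝ (Fin 3))))))
    (hu : ∀ τ : ℝ, τ < 0 → u τ = selfSimilarCollapse γ 0 V τ)
    (hV : V =ᵐ[volume] 0) :
    uncurry u =ᵐ[volume.restrict (Iio (0 : ℝ) ×ˢ (univ : Set (EuclideanSpace ℝ (Fin 3))))] 0 := by
  rw [Measure.volume_eq_prod, ← Measure.prod_restrict, Measure.restrict_univ] at hum ⊢
  -- pass to a strongly measurable modification `ũ`
  set ut := hum.mk (uncurry u) with hut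
  have hS : MeasurableSet {z : ℝ × EuclideanSpace ℝ (Fin 3) | ut z = 0} :=
    hum.stronglyMeasurable_mk.measurableSet_eq_fun stronglyMeasurable_const
  have hae := hum.ae_eq_mk
  -- slices: for a.e. `τ < 0`, `ũ(τ, ·) = u τ = c • V(d ·) = 0` a.e.
  have h1 := Measure.ae_ae_of_ae_prod hae
  have h2 : ∀ᵐ τ ∂((volume : Measure ℝ).restrict (Iio (0 : ℝ))), τ < 0 :=
    ae_restrict_mem measurableSet_Iio
  have h3 : ∀ᵐ τ ∂((volume : Measure ℝ).restrict (Iio (0 : ℝ))),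
      ∀ᵐ x ∂(volume : Measure (EuclideanSpace ℝ (Fin 3))), (τ, x) ∈ {z : ℝ × EuclideanSpace ℝ (Fin 3) | ut z = 0} := by
    filter_upwards [h1, h2] with τ hτ hτ0
    have hs : 0 < -τ := neg_pos.2 hτ0
    have hd : (-τ) ^ (-γ) ≠ 0 := (Real.rpow_pos_of_pos hs _).ne'
    have hVd : (V ∘ fun x : EuclideanSpace ℝ (Fin 3) => (-τ) ^ (-γ) • x) =ᵐ[volume]
        ((0 : EuclideanSpace ℝ (Fin 3) → EuclideanSpace ℝ (Fin 3)) ∘ fun x => (-τ) ^ (-γ) • x) :=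
      (quasiMeasurePreserving_smul hd).ae_eq_comp hV
    filter_upwards [hτ, hVd] with x hx hVx
    have hVx' : V ((-τ) ^ (-γ) • x) = 0 := by simpa using hVx
    have hux : uncurry u (τ, x) = 0 := by
      simp only [uncurry, hu τ hτ0, selfSimilarCollapse_apply, zero_sub, hVx', smul_zero]
    show ut (τ, x) = 0
    rw [hut, ← hx]
    exact hux
  have h4 : ∀ᵐ z ∂(((volume : Measure ℝ).restrict (Iio (0 : ℝ))).prod
      (volume : Measure (EuclideanSpace ℝ (Fin 3)))), z ∈ {z : ℝ × EuclideanSpace ℝ (Fin 3) | ut z = 0} :=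
    (Measure.ae_prod_mem_iff_ae_ae_mem hS).2 h3
  filter_upwards [hae, h4] with z hz hz0
  rw [hz]
  exact hz0

/-- Exponent bookkeeping for the bridge to the tenure kit's `IsSelfSimilarPair`:
`1/(2+ρ) − 1 = −(1+ρ)/(2+ρ)`. [folklore] -/
theorem one_div_two_add_sub_one {ρ : ℝ} (hρ : 0 < ρ) :
    1 / (2 + ρ) - 1 = -((1 + ρ) / (2 + ρ)) := by
  have : (2 + ρ) ≠ 0 := by linarith
  field_simp
  ring

/-- **Bridge (velocity).**  The tenure kit's pointwise self-similarity clause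
`u τ y = (−τ)^{−(1+ρ)/(2+ρ)} • V((−τ)^{−1/(2+ρ)} • y)` (`Lines/rungC_window.lean`,
`IsSelfSimilarPair`, first conjunct) is `u τ = selfSimilarCollapse (1/(2+ρ)) 0 V τ`. [folklore] -/
theorem eq_selfSimilarCollapse_of_pointwise {ρ : ℝ} (hρ : 0 < ρ)
    {u : ℝ → EuclideanSpace ℝ (Fin 3) → EuclideanSpace ℝ (Fin 3)}
    {V : EuclideanSpace ℝ (Fin 3) → EuclideanSpace ℝ (Fin 3)}
    (h : ∀ τ : ℝ, τ < 0 → ∀ y : EuclideanSpace ℝ (Fin 3),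
      u τ y = ((-τ) ^ (-((1 + ρ) / (2 + ρ)))) • V (((-τ) ^ (-(1 / (2 + ρ)))) • y)) :
    ∀ τ : ℝ, τ < 0 → u τ = selfSimilarCollapse (1 / (2 + ρ)) 0 V τ := by
  intro τ hτ
  funext y
  rw [h τ hτ y, selfSimilarCollapse_apply, zero_sub, one_div_two_add_sub_one hρ]

/-- **Bridge (pressure).**  The tenure kit's clause
`p τ y = (−τ)^{−2(1+ρ)/(2+ρ)} P((−τ)^{−1/(2+ρ)} • y)` is
`p τ = selfSimilarCollapsePressure (1/(2+ρ)) 0 P τ`. [folklore] -/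
theorem eq_selfSimilarCollapsePressure_of_pointwise {ρ : ℝ} (hρ : 0 < ρ)
    {p : ℝ → EuclideanSpace ℝ (Fin 3) → ℝ} {P : EuclideanSpace ℝ (Fin 3) → ℝ}
    (h : ∀ τ : ℝ, τ < 0 → ∀ y : EuclideanSpace ℝ (Fin 3),
      p τ y = ((-τ) ^ (-(2 * (1 + ρ) / (2 + ρ)))) * P (((-τ) ^ (-(1 / (2 + ρ)))) • y)) :
    ∀ τ : ℝ, τ < 0 → p τ = selfSimilarCollapsePressure (1 / (2 + ρ)) 0 P τ := by
  intro τ hτ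
  funext y
  rw [h τ hτ y, selfSimilarCollapsePressure_apply, zero_sub, one_div_two_add_sub_one hρ]
  congr 2
  ring

/-- **TRANSFER: rung C1 at exponent `ρ` from a profile Liouville theorem.**  Suppose that every
profile pair `(V, P)` on `ℝ³` with `V` a.e.-strongly measurable, the energy growth
`∫_{B_L} ‖V‖² ≤ c L^{1−2ρ}` (`L > 0`) and the forward profile local energy inequality of
`selfSimilar_profile_energy_le_add_flux` (for every smooth compactly supported `σ ≥ 0`) has
`V = 0` a.e.  Then every EXACTLY SELF-SIMILAR member (exponent `γ = 1/(2+ρ)`) of the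
power-gauged ancient Euler class with exponent `ρ` — the hypotheses of the route crux
`EulerZoomLiouville.PowerGaugeEulerLiouville` — vanishes a.e. on the slab: this is the tenure
kit's rung `Sig.rungC1_selfSimilar` at `ρ` (via the two bridges above).  At the endpoint
`ρ = 1/2` the growth hypothesis reads `V ∈ L²(ℝ³)` (`lintegral_enorm_sq_profile_le_of_half`);
the profile Liouville theorem there is Chae–Shvydkoy's Thm 3.1 WITHOUT its power bounds and
Riesz-pressure hypothesis — open. [cite: ChaeShvydkoy2013, §3.1 Thm. 3.1 and §2.2 eq. (2.9)] -/
theorem rungC1_of_profileLiouville {ρ : ℝ} (hρ : 0 < ρ)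
    (hLiouville : ∀ (V : EuclideanSpace ℝ (Fin 3) → EuclideanSpace ℝ (Fin 3))
        (P : EuclideanSpace ℝ (Fin 3) → ℝ) (c : ℝ≥0),
      AEStronglyMeasurable V volume →
      (∀ L : ℝ, 0 < L → ∫⁻ y in ball (0 : EuclideanSpace ℝ (Fin 3)) L, ‖V y‖ₑ ^ 2 ≤
        (c : ℝ≥0∞) * ENNReal.ofReal (L ^ (1 - 2 * ρ))) →
      (∀ σ : EuclideanSpace ℝ (Fin 3) → ℝ, ContDiff ℝ (⊤ : ℕ∞) σ → HasCompactSupport σ →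
        (∀ x, 0 ≤ σ x) →
        ∀ᵐ τ₁ : ℝ, τ₁ < 0 → ∀ᵐ τ₂ : ℝ, τ₂ ∈ Ioo τ₁ 0 →
          (-τ₂) ^ (5 * (1 / (2 + ρ)) - 2) * ∫ y, ‖V y‖ ^ 2 * σ ((-τ₂) ^ (1 / (2 + ρ)) • y) ≤
            ((-τ₁) ^ (5 * (1 / (2 + ρ)) - 2) * ∫ y, ‖V y‖ ^ 2 * σ ((-τ₁) ^ (1 / (2 + ρ)) • y)) +
              ∫ τ in Ico τ₁ τ₂, (-τ) ^ (6 * (1 / (2 + ρ)) - 3) *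
                ∫ y, (‖V y‖ ^ 2 + 2 * P y) * ⟪V y, gradient σ ((-τ) ^ (1 / (2 + ρ)) • y)⟫) →
      V =ᵐ[volume] 0)
    (u : ℝ → EuclideanSpace ℝ (Fin 3) → EuclideanSpace ℝ (Fin 3))
    (p : ℝ → EuclideanSpace ℝ (Fin 3) → ℝ)
    (H : ℝ → EuclideanSpace ℝ (Fin 3) → EuclideanSpace ℝ (Fin 3) →L[ℝ] EuclideanSpace ℝ (Fin 3))
    (c : ℝ≥0) (V : EuclideanSpace ℝ (Fin 3) → EuclideanSpace ℝ (Fin 3))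
    (P : EuclideanSpace ℝ (Fin 3) → ℝ)
    (hsw : IsSuitableWeakSolutionOn (slab (EuclideanSpace ℝ (Fin 3)) (Iio 0) isOpen_Iio) 0 0 u p)
    (hH : HasWeakSpatialGradientOn (slab (EuclideanSpace ℝ (Fin 3)) (Iio 0) isOpen_Iio) u H)
    (hgauge : ∀ a : ℝ, 0 < a →
      ENNReal.ofReal (a ^ (2 * ρ)) * cknA a (0 : ℝ × EuclideanSpace ℝ (Fin 3)) u +
          ENNReal.ofReal (a ^ ρ) * cknE a (0 : ℝ × EuclideanSpace ℝ (Fin 3)) H +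
        ENNReal.ofReal (a ^ (2 * ρ)) * cknD a (0 : ℝ × EuclideanSpace ℝ (Fin 3)) p ≤ (c : ℝ≥0∞))
    (hu : ∀ τ : ℝ, τ < 0 → u τ = selfSimilarCollapse (1 / (2 + ρ)) 0 V τ)
    (hp : ∀ τ : ℝ, τ < 0 → p τ = selfSimilarCollapsePressure (1 / (2 + ρ)) 0 P τ) :
    uncurry u =ᵐ[volume.restrict (Iio (0 : ℝ) ×ˢ (univ : Set (EuclideanSpace ℝ (Fin 3))))] 0 := by
  have hA : ∀ a : ℝ, 0 < a → ENNReal.ofReal (a ^ (2 * ρ)) *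
      cknA a (0 : ℝ × EuclideanSpace ℝ (Fin 3)) u ≤ (c : ℝ≥0∞) :=
    fun a ha => le_trans (le_trans le_self_add le_self_add) (hgauge a ha)
  have hum : AEStronglyMeasurable (uncurry u)
      (volume.restrict (Iio (0 : ℝ) ×ˢ (univ : Set (EuclideanSpace ℝ (Fin 3))))) := by
    have := hH.locallyIntegrableOn.aestronglyMeasurable
    simpa [slab] using this
  have hVm := aestronglyMeasurable_profile hum hu
  have hgrowth := profile_energy_growth_of_gaugeA hρ hu hA
  have hV0 : V =ᵐ[volume] 0 :=
    hLiouville V P c hVm hgrowth fun σ hσ hσc hσ0 =>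
      selfSimilar_profile_energy_le_add_flux hsw hu hp hσ hσc hσ0
  exact selfSimilar_ae_eq_zero_of_profile hum hu hV0

end Transfer

end Summit.NavierStokesRegularity.NavierStokesRegularity.Theorems.PowerGaugeEulerLiouville
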